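import Summits.KontsevichZagierPeriods.KontsevichZagierPeriods.Theorems.RootDecompRationalCubeDichotomyNashMultiGenP16
import Mathlib.Algebra.Polynomial.Bivariate
import Mathlib.Algebra.Polynomial.Taylor
import Mathlib.Algebra.Polynomial.HasseDeriv
import Mathlib.Algebra.Polynomial.Div
import Mathlib.Algebra.Polynomial.Roots
import Mathlib.Analysis.Analytic.IsolatedZeros
import Mathlib.LinearAlgebra.Matrix.Block
import Mathlib.Analysis.Calculus.Deriv.Pi
import Mathlib.Analysis.Calculus.Deriv.Polynomial
import Mathlib.Analysis.Calculus.Deriv.Comp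
import Mathlib.Analysis.Calculus.Deriv.Mul

/-! lens-2 g9 §8 (NashEtaleMultiGen.lean v9 @d1449b6f, l.5151–5825: `SliceNash 1` — the ramified one-variable case over `K` by Newton–Tougeron division; `multiGenDefectOne_holds` closes item 33041 BY NAME) — continuation of the census chain P01–P16 (v8 §§1–7). -/

/-! # `RootDecompRationalCubeDichotomyNashMultiGenP17` — part 1/3 of the mechanical ≤360-line split of `src.lean`
(split by the decomp-kz census seat for landing; mathematics unchanged). -/

open Set MvPolynomial Filter Topology
open Literature.NumberTheory.Transcendental (IsSemialgebraicFunOn)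
open Literature.ModelTheory.ExponentialFields (IsSemialgebraic isSemialgebraic_setOf_eval_pos
  isSemialgebraic_setOf_eval_ne_zero)

namespace Summit.KontsevichZagierPeriods.RootDecompRationalCubeDichotomy.Rung29430.MultiGen

open Summit.KontsevichZagierPeriods.KontsevichZagierPeriods.Theses.RootDecompRationalCubeDichotomy
  (NashEtaleCover NashEtaleLocal PiRationalisation)
open Summit.KontsevichZagierPeriods.RootDecompRationalCubeDichotomy.Rung29430.NashEtaleLocalGlue
  (local_of_simple nashEtaleCover_of_nashEtaleLocal nashEtaleLocal_zero)
open Summit.KontsevichZagierPeriods.RootDecompRationalCubeDichotomy.Rung29430.NashEtaleLocalOne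
  (analyticOnNhd_aeval_snoc)
open Summit.KontsevichZagierPeriods.RootDecompRationalCubeDichotomy.RungEtale.Etale
  (piRationalisation_of_nashEtaleCover)

noncomputable section

/-! ### §8  `SliceNash 1` — the ramified one-variable case over `K` by Newton–Tougeron division (g9)

We prove `OriginNashExists 1`: a `K`-semialgebraic real-analytic `G` near `0 ∈ ℝ¹` is, near `0`,
`A(t, y(t)) / B(t, y(t))` along an analytic solution `y(t)` of a square `K`-polynomial system
`F(t, y) = 0` with invertible Jacobian `∂F/∂y (0, y(0))`.  Writing `f s := G (s)` and choosing a
`K`-relation `Q(t, w)` (`Q ∈ K[X][Y]`, `Q(s, f s) = 0` near `0`) of least `w`-degree, the partial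
`∂_w Q (s, f s) = s ^ d · ψ s` with `ψ 0 ≠ 0`.  With the Taylor data
`f s = Σ_{i ≤ d} cᵢ sⁱ + s^{d+1} u(s)` (`cᵢ, u` again `K`-semialgebraic, §7) we take the unknowns
`y = (z₀,…,z_d, U)`, `W := Σ zᵢ tⁱ + U t^{d+1}`, and
`F := (M₀(z₀), …, M_d(z_d), Q(t, W) /ₘ t^{2d+1})`, `A := W`, `B := 1`, where `Mᵢ ∈ K[z]` has the
simple root `cᵢ` (§7 (K3)).  The Jacobian at `(0; c, u 0)` is lower-triangular with diagonal
`(M₀'(c₀), …, M_d'(c_d), ψ 0)`.  (Uniform in `d`; `d = 0` is the unramified case.) -/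

section OriginOne

open Literature.NumberTheory.Transcendental Literature.ModelTheory.ExponentialFields
open Function
open scoped Polynomial.Bivariate

variable {K : Type} [CommRing K] [Algebra K ℝ]

/-! #### §8.1 Algebraic plumbing: `K[X][Y]`, `K[y][t]`, specialisation and evaluation -/

/-- The real image in `ℝ[X][Y]` of a bivariate polynomial over `K`. -/
def bivR (Q : Polynomial (Polynomial K)) : Polynomial (Polynomial ℝ) :=
  Q.map (Polynomial.mapRingHom (algebraMap K ℝ))

/-- Specialise the parameters `y ↦ (y : ℝᵏ)` of a polynomial in `t` with coefficients in `K[y]`. -/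
def spec {k : ℕ} (y : Fin k → ℝ) (p : Polynomial (MvPolynomial (Fin k) K)) :
    Polynomial ℝ :=
  p.map (MvPolynomial.aeval y : MvPolynomial (Fin k) K →ₐ[K] ℝ).toRingHom

/-- `K[y][t] → K[t, y]` (`t ↦ X (castAdd k 0)`, `yⱼ ↦ X (natAdd 1 j)`). -/
def toMv (k : ℕ) : Polynomial (MvPolynomial (Fin k) K) →ₐ[K] MvPolynomial (Fin (1 + k)) K :=
  Polynomial.aevalTower (MvPolynomial.rename (Fin.natAdd 1)) (MvPolynomial.X (Fin.castAdd k 0))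

/-- Auxiliary step `spec_add`. [bookkeeping] -/
theorem spec_add {k : ℕ} (y : Fin k → ℝ) (p q : Polynomial (MvPolynomial (Fin k) K)) :
    spec y (p + q) = spec y p + spec y q := by
  simp [spec, Polynomial.map_add]

/-- Auxiliary step `spec_divByMonic_X_pow`. [bookkeeping] -/
theorem spec_divByMonic_X_pow {k : ℕ} (y : Fin k → ℝ) (p : Polynomial (MvPolynomial (Fin k) K))
    (e : ℕ) : spec y (p /ₘ Polynomial.X ^ e) = spec y p /ₘ Polynomial.X ^ e := by
  rw [spec, spec, Polynomial.map_divByMonic _ (Polynomial.monic_X_pow e), Polynomial.map_pow,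
    Polynomial.map_X]

/-- Evaluation of `toMv p` at `(t, y)` is evaluation of the specialisation `spec y p` at `t 0`. -/
theorem aeval_append_toMv {k : ℕ} (t : Fin 1 → ℝ) (y : Fin k → ℝ)
    (p : Polynomial (MvPolynomial (Fin k) K)) :
    MvPolynomial.aeval (Fin.append t y) (toMv k p) = (spec y p).eval (t 0) := by
  induction p using Polynomial.induction_on' with
  | add p q hp hq => rw [map_add, map_add, hp, hq, spec_add, Polynomial.eval_add]
  | monomial n a =>
    have hcomp : Fin.append t y ∘ Fin.natAdd 1 = y := funext fun i => by simp
    rw [← Polynomial.C_mul_X_pow_eq_monomial]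
    simp only [toMv, spec, map_mul, map_pow, Polynomial.aevalTower_C, Polynomial.aevalTower_X,
      MvPolynomial.aeval_rename, hcomp, MvPolynomial.aeval_X, Fin.append_left, Polynomial.map_mul,
      Polynomial.map_pow, Polynomial.map_C, Polynomial.map_X, Polynomial.eval_mul,
      Polynomial.eval_pow, Polynomial.eval_C, Polynomial.eval_X, AlgHom.toRingHom_eq_coe,
      RingHom.coe_coe]

/-- Evaluation of the specialised substitution `Q(t, W)` is `Q^ℝ (s, W_y(s))`. -/
theorem eval_spec_aevalAeval {k : ℕ} (y : Fin k → ℝ) (W : Polynomial (MvPolynomial (Fin k) K))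
    (Q : Polynomial (Polynomial K)) (s : ℝ) :
    (spec y (Polynomial.aevalAeval Polynomial.X W Q)).eval s =
      (bivR Q).evalEval s ((spec y W).eval s) := by
  have key : ((Polynomial.evalRingHom s).comp
      ((Polynomial.mapRingHom
          (MvPolynomial.aeval y : MvPolynomial (Fin k) K →ₐ[K] ℝ).toRingHom).comp
        (Polynomial.aevalAeval Polynomial.X W :
          Polynomial (Polynomial K) →ₐ[K] Polynomial (MvPolynomial (Fin k) K)).toRingHom)) =
      (Polynomial.evalEvalRingHom s ((spec y W).eval s)).comp
        (Polynomial.mapRingHom (Polynomial.mapRingHom (algebraMap K ℝ))) := by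
    ext
    · simp [spec]
    · simp [spec]
    · simp [spec]
  have := congrArg (fun φ => φ Q) key
  simpa [spec, bivR] using this

/-- `P(x₀, x₁) ↦ P(X, Y) ∈ K[X][Y]`. -/
def toBiv (P : MvPolynomial (Fin 2) K) : Polynomial (Polynomial K) :=
  MvPolynomial.aeval
    (![Polynomial.C Polynomial.X, Polynomial.X] : Fin 2 → Polynomial (Polynomial K)) P

/-- The relation `toBiv P = P(C X, Y)` attached to `P ∈ K[x₀, x₁]` evaluates as `P`. -/
theorem evalEval_bivR_toBiv (P : MvPolynomial (Fin 2) K) (s w : ℝ) :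
    (bivR (toBiv P)).evalEval s w = MvPolynomial.aeval ![s, w] P := by
  have key : ((Polynomial.evalEvalRingHom s w).comp
      ((Polynomial.mapRingHom (Polynomial.mapRingHom (algebraMap K ℝ))).comp
        (MvPolynomial.aeval
          (![Polynomial.C Polynomial.X, Polynomial.X] : Fin 2 → Polynomial (Polynomial K)) :
          MvPolynomial (Fin 2) K →ₐ[K] Polynomial (Polynomial K)).toRingHom)) =
      (MvPolynomial.aeval ![s, w] : MvPolynomial (Fin 2) K →ₐ[K] ℝ).toRingHom := by
    refine MvPolynomial.ringHom_ext (fun r => ?_) (fun i => ?_)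
    · simp
    · fin_cases i <;> simp
  have := congrArg (fun φ => φ P) key
  simpa [bivR, toBiv] using this

/-- `Q ↦ Q^ℝ` commutes with `∂/∂w`. -/
theorem bivR_derivative (Q : Polynomial (Polynomial K)) :
    bivR (Polynomial.derivative Q) = Polynomial.derivative (bivR Q) := by
  rw [bivR, bivR, Polynomial.derivative_map]

/-- `evalEval` as a finite sum over the `w`-coefficients. -/
theorem evalEval_eq_sum_range (P : Polynomial (Polynomial ℝ)) (s w : ℝ) :
    P.evalEval s w =
      ∑ i ∈ Finset.range (P.natDegree + 1), (P.coeff i).eval s * w ^ i := by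
  have h := congrFun (congrFun (Polynomial.eval₂_evalRingHom s) w) P
  rw [← h, Polynomial.eval₂_eq_sum_range]
  rfl

/-- Hasse derivatives commute with `map`. -/
theorem hasseDeriv_map' {R S : Type*} [Semiring R] [Semiring S] (φ : R →+* S) (n : ℕ)
    (p : Polynomial R) :
    Polynomial.hasseDeriv n (p.map φ) = (Polynomial.hasseDeriv n p).map φ := by
  ext i
  simp [Polynomial.hasseDeriv_coeff, Polynomial.coeff_map]

/-- **Taylor's formula in `w`** for `P ∈ ℝ[X][Y]`:
`P(s, w) = Σ_{j < n} (H_j P)(s, w₀) (w - w₀)^j` (`H_j` = Hasse derivative, `n > deg_w P`). -/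
theorem evalEval_taylor_sum (P : Polynomial (Polynomial ℝ)) {n : ℕ} (hn : P.natDegree < n)
    (s w w₀ : ℝ) :
    P.evalEval s w = ∑ j ∈ Finset.range n,
      (Polynomial.hasseDeriv j P).evalEval s w₀ * (w - w₀) ^ j := by
  have h1 : P.evalEval s w =
      (Polynomial.taylor w₀ (P.map (Polynomial.evalRingHom s))).eval (w - w₀) := by
    rw [Polynomial.taylor_eval, sub_add_cancel, Polynomial.map_evalRingHom_eval]
  have hdeg : (Polynomial.taylor w₀ (P.map (Polynomial.evalRingHom s))).natDegree < n := by
    rw [Polynomial.natDegree_taylor]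
    exact lt_of_le_of_lt Polynomial.natDegree_map_le hn
  rw [h1, Polynomial.eval_eq_sum_range' hdeg]
  refine Finset.sum_congr rfl fun j _ => ?_
  rw [Polynomial.taylor_coeff, hasseDeriv_map', Polynomial.map_evalRingHom_eval]

/-- `s ↦ P(s, g s)` is analytic where `g` is. -/
theorem analyticAt_evalEval (P : Polynomial (Polynomial ℝ)) {g : ℝ → ℝ} {s₀ : ℝ}
    (hg : AnalyticAt ℝ g s₀) : AnalyticAt ℝ (fun s => P.evalEval s (g s)) s₀ := by
  have h : (fun s => P.evalEval s (g s)) = fun s =>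
      ∑ i ∈ Finset.range (P.natDegree + 1), (P.coeff i).eval s * g s ^ i :=
    funext fun s => evalEval_eq_sum_range P s (g s)
  rw [h]
  refine Finset.analyticAt_fun_sum _ fun i _ => ?_
  exact ((AnalyticOnNhd.eval_polynomial (𝕜 := ℝ) (P.coeff i)) s₀ (Set.mem_univ _)).mul
    (hg.pow i)

/-- From `X ^ e ∣ q`: `s ^ e · (q /ₘ X^e)(s) = q(s)`. -/
theorem pow_mul_eval_divByMonic {e : ℕ} {q : Polynomial ℝ} (hdvd : Polynomial.X ^ e ∣ q) (s : ℝ) :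
    s ^ e * (q /ₘ Polynomial.X ^ e).eval s = q.eval s := by
  have hfac : Polynomial.X ^ e * (q /ₘ Polynomial.X ^ e) = q := by
    have := Polynomial.modByMonic_add_div q (Polynomial.X ^ e)
    rwa [(Polynomial.modByMonic_eq_zero_iff_dvd (Polynomial.monic_X_pow e)).mpr hdvd,
      zero_add] at this
  conv_rhs => rw [← hfac]
  rw [Polynomial.eval_mul, Polynomial.eval_pow, Polynomial.eval_X]

/-- **(L2)** If `q(t) = t ^ e · h t` near `0` with `h` continuous at `0`, then
`(q /ₘ X^e)(0) = h 0`. -/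
theorem eval_divByMonic_zero_of_eventually {e : ℕ} {q : Polynomial ℝ} {h : ℝ → ℝ}
    (hh : ContinuousAt h 0) (hq : ∀ᶠ t in 𝓝 (0:ℝ), q.eval t = t ^ e * h t) :
    (q /ₘ Polynomial.X ^ e).eval 0 = h 0 := by
  have hdvd := X_pow_dvd_of_eventually_eq hh hq
  set r := q /ₘ Polynomial.X ^ e with hr
  have hne : ∀ᶠ t in 𝓝[≠] (0:ℝ), r.eval t = h t := by
    filter_upwards [hq.filter_mono nhdsWithin_le_nhds, self_mem_nhdsWithin] with t ht htne
    have h2 : t ^ e * r.eval t = t ^ e * h t := by rw [pow_mul_eval_divByMonic hdvd, ht]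
    exact mul_left_cancel₀ (pow_ne_zero e htne) h2
  have hc1 : Tendsto (fun t => r.eval t) (𝓝[≠] (0:ℝ)) (𝓝 (r.eval 0)) :=
    r.continuous.continuousAt.tendsto.mono_left nhdsWithin_le_nhds
  have hc2 : Tendsto h (𝓝[≠] (0:ℝ)) (𝓝 (h 0)) := hh.tendsto.mono_left nhdsWithin_le_nhds
  exact tendsto_nhds_unique (hc1.congr' hne) hc2

/-! #### §8.2 Calculus plumbing: partial derivatives of polynomial maps as one-variable derivatives -/

/-- **(D)** `∂ⱼ p (x)` is the derivative of `s ↦ p(x with xⱼ := s)` at `s = xⱼ`. -/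
theorem hasDerivAt_aeval_update {n : ℕ} (p : MvPolynomial (Fin n) K) (x : Fin n → ℝ) (j : Fin n) :
    HasDerivAt (fun s : ℝ => MvPolynomial.aeval (Function.update x j s) p)
      (MvPolynomial.aeval x (pderiv j p)) (x j) := by
  have h1 : HasFDerivAt (fun z : Fin n → ℝ => MvPolynomial.aeval z p) (NashImplicitK.D p x)
      (Function.update x j (x j)) := by
    rw [Function.update_eq_self]
    exact (NashImplicitK.hasStrictFDerivAt_aeval p x).hasFDerivAt
  have h2 := h1.comp_hasDerivAt (x j) (hasDerivAt_update x j (x j))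
  have h3 : NashImplicitK.D p x (Pi.single j (1:ℝ)) = MvPolynomial.aeval x (pderiv j p) := by
    rw [NashImplicitK.D_apply]
    simp only [Pi.single_apply, mul_ite, mul_one, mul_zero]
    rw [Finset.sum_ite_eq' Finset.univ j]
    simp
  rw [h3] at h2
  exact h2

/-- Corollary of **(D)**: compute `∂ⱼ p (x)` from any known derivative of the coordinate slice. -/
theorem aeval_pderiv_eq_of_hasDerivAt {n : ℕ} {p : MvPolynomial (Fin n) K} {x : Fin n → ℝ}
    {j : Fin n} {g' : ℝ}
    (h : HasDerivAt (fun s : ℝ => MvPolynomial.aeval (Function.update x j s) p) g' (x j)) :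
    MvPolynomial.aeval x (pderiv j p) = g' :=
  (hasDerivAt_aeval_update p x j).unique h

/-- Updating a `y`-coordinate of `(t, y)`. -/
theorem update_append_natAdd {k : ℕ} (t : Fin 1 → ℝ) (y : Fin k → ℝ) (j : Fin k) (s : ℝ) :
    Function.update (Fin.append t y) (Fin.natAdd 1 j) s = Fin.append t (Function.update y j s) := by
  funext i
  by_cases hi : i = Fin.natAdd 1 j
  · subst hi
    simp
  · rw [Function.update_of_ne hi]
    induction i using Fin.addCases with
    | left i => simp
    | right i =>
      have hij : i ≠ j := fun h => hi (by rw [h])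
      simp [hij]

/-- A one-variable `K`-polynomial in the variable `X idx`, evaluated. -/
theorem aeval_polynomial_aeval_X {N : ℕ} (z : Fin N → ℝ) (idx : Fin N) (M : Polynomial K) :
    MvPolynomial.aeval z (Polynomial.aeval (MvPolynomial.X idx : MvPolynomial (Fin N) K) M) =
      Polynomial.aeval (z idx) M := by
  rw [← Polynomial.aeval_algHom_apply, MvPolynomial.aeval_X]

/-! #### §8.3 Two algebraic identities used in the division step -/

/-- Taylor expansion in `w` split off at order `2`:
`P(s, w₀ + v) = P(s, w₀) + ∂_w P(s, w₀)·v + Σ_{i < deg_w P} H_{i+2}P(s, w₀)·v^{i+2}`. -/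
theorem evalEval_taylor_split (P : Polynomial (Polynomial ℝ)) (s w₀ v : ℝ) :
    P.evalEval s (w₀ + v) = P.evalEval s w₀ + (Polynomial.derivative P).evalEval s w₀ * v +
      ∑ i ∈ Finset.range P.natDegree,
        (Polynomial.hasseDeriv (i + 2) P).evalEval s w₀ * v ^ (i + 2) := by
  rw [evalEval_taylor_sum P (show P.natDegree < P.natDegree + 2 by omega) s (w₀ + v) w₀,
    Finset.sum_range_succ', Finset.sum_range_succ']
  have hsum : ∑ i ∈ Finset.range P.natDegree,
      (Polynomial.hasseDeriv (i + 1 + 1) P).evalEval s w₀ * (w₀ + v - w₀) ^ (i + 1 + 1) =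
      ∑ i ∈ Finset.range P.natDegree,
        (Polynomial.hasseDeriv (i + 2) P).evalEval s w₀ * v ^ (i + 2) := by
    refine Finset.sum_congr rfl fun i _ => ?_
    have hi : i + 1 + 1 = i + 2 := rfl
    rw [hi, add_sub_cancel_left]
  rw [hsum]
  simp only [add_sub_cancel_left, pow_zero, mul_one, pow_one, Polynomial.hasseDeriv_zero',
    Polynomial.hasseDeriv_one', zero_add]
  ring

/-- The bookkeeping of powers of `s` in the division step (`e = 2d+1`). -/
theorem division_identity (s ψs v : ℝ) (d m : ℕ) (Hs : ℕ → ℝ) :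
    0 + s ^ d * ψs * (s ^ (d + 1) * v) +
        ∑ i ∈ Finset.range m, Hs (i + 2) * (s ^ (d + 1) * v) ^ (i + 2) =
      s ^ (2 * d + 1) * (ψs * v +
        ∑ i ∈ Finset.range m, Hs (i + 2) * (s ^ ((d + 1) * i + 1) * v ^ (i + 2))) := by
  have hterm : ∀ i : ℕ, Hs (i + 2) * (s ^ (d + 1) * v) ^ (i + 2) =
      s ^ (2 * d + 1) * (Hs (i + 2) * (s ^ ((d + 1) * i + 1) * v ^ (i + 2))) := by
    intro i
    have hexp : (d + 1) * (i + 2) = (2 * d + 1) + ((d + 1) * i + 1) := by ring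
    rw [mul_pow (s ^ (d + 1)) v (i + 2), ← pow_mul s (d + 1) (i + 2), hexp,
      pow_add s (2 * d + 1) ((d + 1) * i + 1)]
    ring
  rw [Finset.sum_congr rfl fun i _ => hterm i, ← Finset.mul_sum]
  have hexp2 : s ^ (2 * d + 1) = s ^ d * s ^ (d + 1) := by
    rw [← pow_add]
    congr 1
    ring
  rw [hexp2]
  ring

/-! #### §8.4 A minimal `K`-relation and the order of `∂_w Q` along the graph (K4) -/

end OriginOne
end
end Summit.KontsevichZagierPeriods.RootDecompRationalCubeDichotomy.Rung29430.MultiGen
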